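import Literature.MathematicalPhysics.QuantumFieldTheory.Balaban1983to89.Beta.PlaquetteVertex

/-!
# The `(2,1)`-jet of the Wilson plaquette sum UNDER AN AXIS REFLECTION in the product chart: a swap/rotation calculus for two-sorted
# words, the two reflected plaquette words, and THE JET LAW WITH CONTACT `jet21_pull`
# (β sub-cell, row BETA-an3, gen 28, stage S1 of «WILSON-REFLECTION-WITH-CONTACT»; demand NOTE X-an2-45 §3 (ii)/(R45-4), BINDER-OWNERS D1 (iii))

HONEST FRAMING (cell charter, verbatim): «discharging BetaPertH makes Balaban's UV stability UNCONDITIONAL — a real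
constructive-QFT result; it is NOT the continuum limit and NOT the Clay problem.»  HONEST DEPENDENCY: continuum YM on T⁴ ⇐ BetaPertH ∧
nine spine estimates (0/9 proved); BetaPertH ⇐ (D1) ∧ (D4) ∧ CAP+tail; G-an2-4 gates asym, D1 and NE2/3/4.  DERIVED cell leaf (pub-balaban
β sub-cell, lane an3 gen 28): pure non-commutative word algebra and finite lattice bookkeeping over an3's `WilsonVertex` /
`PlaquetteVertex` (Literature, [folklore] kernel algebra); no statement of Bałaban's papers is typed here, no `[cite:]` tag, no `Prop`
fact, no binder of the β-function wall is instantiated.  ABSOLUTE RULE respected: nothing internally minted is cited — every line below is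
kernel-proved.  NOT `BetaPertH`; NOT continuum; NOT Clay.

## What is here ([folklore]; `τ` any `𝕜`-linear tracial functional, `𝔸` any normed `𝕜`-algebra, no commutativity, no completeness)

* §1 WORD CALCULUS for the trace of the `(2,1)`-jet `τ ∘ P21` (`WilsonVertex.P21`, normal form `WilsonVertex.trace_P21`):
  **`trace_P21_swap`** — exchanging an adjacent pair `(B, b)(W, w) ↦ (W, w)(B, b)` costs exactly `τ(Z_W · [b, w])`, `Z_W` the sum of all
  fluctuation letters (`twistAux_swap`); **`trace_P21_rotate`** — `τP21(L ++ M) = τP21(M ++ L)` (base-point independence of `tr U(∂p)` at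
  jet level, by cyclicity alone); the two REFLECTED PLAQUETTE WORDS **`trace_P21_plaq_reflect₁/₂`**: the word of a plaquette read after an
  axis reflection in the product chart `U = e^{W}e^{B}` is the image plaquette's word ROTATED by one bond with both axis-parallel letter
  pairs ORDER-SWAPPED (`(e^{W}e^{B})⁻¹ = e^{−B}e^{−W} ≠ e^{−W}e^{−B}`), hence its `(2,1)`-trace is the image's PLUS A CONTACT
  `τ(Z_W · ([b, w](far α-bond) − [b, w](near α-bond)))`.
* §2 THE LATTICE: `pull σ e α X` — the product-chart pull-back of a bond field under a site involution `σ` reflecting the axis `α`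
  (`σ(x + e_κ) = σx + e_κ`, `κ ≠ α`; `σ(x + e_α) = σx − e_α`; `α`-bonds land reversed, letters negated); `axComm W B α y = [B_α(y), W_α(y)]`;
  per plaquette `plaqWord_pull_of_ne`, `trace_P21_plaqWord_pull_fst/snd`; and the headline
  **`jet21_pull : jet21 𝕜 τ e (pull σ e α W) (pull σ e α B) = jet21 𝕜 τ e W B + 2 • Σ_y Σ_ν τ(lcurl e W y ν α · (axComm (y + e_ν) − axComm y))`**
  — the summed `(2,1)`-jet (`PlaquetteVertex.jet21`, all ordered direction pairs) is reflection-invariant UP TO the explicit contact: the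
  `α`-row of the fluctuation curl paired with the discrete forward difference of the same-bond commutator density.  For a one-bond
  background `B = bondLetter u κ′ Y` the contact is supported at the jet bond and vanishes unless `κ′ = α` (stage S2, separate leaf:
  coordinates, polarisation, colour stripping ⇒ the entrywise law of the antisymmetrised first-order stencil with an2's contact
  `DiagonalContact.conjV_bhKAt_ctGen_inl_inl`).

READING (context; asserted nowhere): this is the mechanism behind the (Sr-conj) socket `S κ′ (bref α κ′ u) = reflSign α κ′ • refK (Φ N α)
(S κ′ u + conjV M (C κ′ u))` of `ChartConjugationReflection` for the Wilson piece `cE • wilsonA`: the symmetric stencil of a smooth action is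
covariant under the lattice symmetry, the product chart is not, and the defect is a same-bond BCH commutator on the reversed (`α`-parallel)
bonds.  All declarations `[folklore]`; axioms standard.  Provenance: b2b-balaban β sub-cell, unit beta-an3 gen 28, 2026-08-20 (v1); over
an3's `WilsonVertex`, `PlaquetteVertex` BY NAME; no existing file touched.
-/

namespace Summit.QuantumFields.BalabanUV.Beta.WilsonJetReflection

open Literature.MathematicalPhysics.QuantumFieldTheory.Balaban1983to89.Beta.TransportVertices (quad commSum commSum_cons commSum_nil)
open Literature.MathematicalPhysics.QuantumFieldTheory.Balaban1983to89.Beta.WilsonVertex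

section Words

variable (𝕜 : Type*) [RCLike 𝕜] {𝔸 : Type*} [NormedRing 𝔸] [NormedAlgebra 𝕜 𝔸]
variable {V : Type*} [AddCommGroup V] [Module 𝕜 V]

omit [NormedAlgebra 𝕜 𝔸] in
/-- [folklore] SWAPPING AN ADJACENT `B`-`W` PAIR changes the transport sum by the commutator `[b, w]`. -/
theorem twistAux_swap (β b w : 𝔸) (L₁ L₂ : List (Bool × 𝔸)) :
    twistAux β (L₁ ++ (false, b) :: (true, w) :: L₂) =
      twistAux β (L₁ ++ (true, w) :: (false, b) :: L₂) + (b * w - w * b) := by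
  rw [twistAux_append, twistAux_append, twistAux_consB, twistAux_consW, twistAux_consW, twistAux_consB]
  noncomm_ring

/-- [folklore] cyclicity, three letters: `τ(a(bc)) = τ(b(ca))`. -/
theorem trace_cyc (τ : 𝔸 →ₗ[𝕜] V) (hτ : ∀ a b : 𝔸, τ (a * b) = τ (b * a)) (a b c : 𝔸) :
    τ (a * (b * c)) = τ (b * (c * a)) := by
  rw [hτ, mul_assoc]

/-- [folklore] cyclicity, three letters: `τ(a(bc)) = τ(c(ab))`. -/
theorem trace_cyc' (τ : 𝔸 →ₗ[𝕜] V) (hτ : ∀ a b : 𝔸, τ (a * b) = τ (b * a)) (a b c : 𝔸) :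
    τ (a * (b * c)) = τ (c * (a * b)) := by
  rw [← mul_assoc, hτ]

/-- [folklore] **THE SWAP LEMMA**: exchanging an adjacent pair `(B, b), (W, w) ↦ (W, w), (B, b)` inside a two-sorted word changes the
trace of the `(2,1)`-jet by `τ(Z_W · [b, w])`, `Z_W` = the sum of ALL fluctuation letters of the word. -/
theorem trace_P21_swap (τ : 𝔸 →ₗ[𝕜] V) (hτ : ∀ a b : 𝔸, τ (a * b) = τ (b * a)) (b w : 𝔸) (L₁ L₂ : List (Bool × 𝔸)) :
    τ (P21 𝕜 (L₁ ++ (false, b) :: (true, w) :: L₂)) =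
      τ (P21 𝕜 (L₁ ++ (true, w) :: (false, b) :: L₂))
        + τ ((wpart (L₁ ++ (true, w) :: (false, b) :: L₂)).sum * (b * w - w * b)) := by
  rw [trace_P21 𝕜 τ hτ, trace_P21 𝕜 τ hτ]
  have hw : wpart (L₁ ++ (false, b) :: (true, w) :: L₂) = wpart (L₁ ++ (true, w) :: (false, b) :: L₂) := by simp
  have hb : bpart (L₁ ++ (false, b) :: (true, w) :: L₂) = bpart (L₁ ++ (true, w) :: (false, b) :: L₂) := by simp
  rw [hw, hb, twistAux_swap, mul_add, map_add]
  abel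

/-- [folklore] **THE ROTATION LEMMA**: the trace of the `(2,1)`-jet of a two-sorted word is invariant under cyclic rotation of the word
(`tr U(∂p)` does not depend on the base point of the loop). -/
theorem trace_P21_rotate (τ : 𝔸 →ₗ[𝕜] V) (hτ : ∀ a b : 𝔸, τ (a * b) = τ (b * a)) (L M : List (Bool × 𝔸)) :
    τ (P21 𝕜 (L ++ M)) = τ (P21 𝕜 (M ++ L)) := by
  rw [trace_P21 𝕜 τ hτ, trace_P21 𝕜 τ hτ]
  simp only [wpart_append, bpart_append, List.sum_append, commSum_append', twistAux_append, zero_add]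
  rw [twistAux_eq ((bpart L).sum) M, twistAux_eq ((bpart M).sum) L]
  set XL := (wpart L).sum
  set XM := (wpart M).sum
  set YL := (bpart L).sum
  set YM := (bpart M).sum
  simp only [mul_add, add_mul, mul_sub, map_add, map_sub, smul_add, smul_sub]
  rw [trace_cyc 𝕜 τ hτ XL YL XM, trace_cyc 𝕜 τ hτ XM YL XM, trace_cyc' 𝕜 τ hτ XL XM YL, trace_cyc' 𝕜 τ hτ XM XM YL,
    trace_cyc 𝕜 τ hτ XL YM XL, trace_cyc 𝕜 τ hτ XM YM XL, trace_cyc' 𝕜 τ hτ XL XL YM, trace_cyc' 𝕜 τ hτ XM XL YM]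
  module

/-- [folklore] **REFLECTED PLAQUETTE WORD, first kind** (the reflected axis is the FIRST direction of the plaquette): the word read from the
product-chart pull-backs is the target word rotated by one bond with both axis-parallel letter pairs order-swapped, so its `(2,1)`-trace is
the target's plus the CONTACT `τ(Z_W · ([b₂, w₂] − [b₄, w₄]))`. -/
theorem trace_P21_plaq_reflect₁ (τ : 𝔸 →ₗ[𝕜] V) (hτ : ∀ a b : 𝔸, τ (a * b) = τ (b * a)) (w₁ w₂ w₃ w₄ b₁ b₂ b₃ b₄ : 𝔸) :
    τ (P21 𝕜 (plaq (-w₄) w₁ (-w₂) w₃ (-b₄) b₁ (-b₂) b₃)) =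
      τ (P21 𝕜 (plaq w₁ w₂ w₃ w₄ b₁ b₂ b₃ b₄))
        + τ ((w₁ + w₂ - w₃ - w₄) * ((b₂ * w₂ - w₂ * b₂) - (b₄ * w₄ - w₄ * b₄))) := by
  -- the reflected word, with the pair `(B, b₂), (W, w₂)` exposed
  have e1 : plaq (-w₄) w₁ (-w₂) w₃ (-b₄) b₁ (-b₂) b₃ =
      [(true, -w₄), (false, -b₄), (true, w₁), (false, b₁)] ++ (false, b₂) :: (true, w₂) :: [(false, -b₃), (true, -w₃)] := by
    simp only [plaq, neg_neg]; rfl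
  -- after the first swap: a rotation of the word `M ++ [(W, −w₄), (B, −b₄)]`
  have e2 : [(true, -w₄), (false, -b₄), (true, w₁), (false, b₁)] ++ (true, w₂) :: (false, b₂) :: [(false, -b₃), (true, -w₃)] =
      [(true, -w₄), (false, -b₄)] ++ [(true, w₁), (false, b₁), (true, w₂), (false, b₂), (false, -b₃), (true, -w₃)] := rfl
  have e3 : [(true, w₁), (false, b₁), (true, w₂), (false, b₂), (false, -b₃), (true, -w₃)] ++ [(true, -w₄), (false, -b₄)] =
      [(true, w₁), (false, b₁), (true, w₂), (false, b₂), (false, -b₃), (true, -w₃)] ++ (true, -w₄) :: (false, -b₄) :: [] := rfl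
  have e4 : plaq w₁ w₂ w₃ w₄ b₁ b₂ b₃ b₄ =
      [(true, w₁), (false, b₁), (true, w₂), (false, b₂), (false, -b₃), (true, -w₃)] ++ (false, -b₄) :: (true, -w₄) :: [] := rfl
  have hZ1 : (wpart ([(true, -w₄), (false, -b₄), (true, w₁), (false, b₁)] ++ (true, w₂) :: (false, b₂) :: [(false, -b₃), (true, -w₃)])).sum
      = w₁ + w₂ - w₃ - w₄ := by
    simp; abel
  have hZ2 : (wpart ([(true, w₁), (false, b₁), (true, w₂), (false, b₂), (false, -b₃), (true, -w₃)] ++ (true, -w₄) :: (false, -b₄) :: [])).sum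
      = w₁ + w₂ - w₃ - w₄ := by
    simp; abel
  rw [e1, trace_P21_swap 𝕜 τ hτ, hZ1, e2, trace_P21_rotate 𝕜 τ hτ, e4, trace_P21_swap 𝕜 τ hτ, hZ2, e3]
  simp only [neg_mul, mul_neg, neg_neg, mul_sub, map_sub]
  abel

/-- [folklore] **REFLECTED PLAQUETTE WORD, second kind** (the reflected axis is the SECOND direction of the plaquette). -/
theorem trace_P21_plaq_reflect₂ (τ : 𝔸 →ₗ[𝕜] V) (hτ : ∀ a b : 𝔸, τ (a * b) = τ (b * a)) (w₁ w₂ w₃ w₄ b₁ b₂ b₃ b₄ : 𝔸) :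
    τ (P21 𝕜 (plaq w₂ (-w₃) w₄ (-w₁) b₂ (-b₃) b₄ (-b₁))) =
      τ (P21 𝕜 (plaq w₁ w₂ w₃ w₄ b₁ b₂ b₃ b₄))
        + τ ((w₃ + w₄ - w₁ - w₂) * ((b₃ * w₃ - w₃ * b₃) - (b₁ * w₁ - w₁ * b₁))) := by
  -- the reflected word, with the pair `(B, b₁), (W, w₁)` exposed at the end
  have e1 : plaq w₂ (-w₃) w₄ (-w₁) b₂ (-b₃) b₄ (-b₁) =
      [(true, w₂), (false, b₂), (true, -w₃), (false, -b₃), (false, -b₄), (true, -w₄)] ++ (false, b₁) :: (true, w₁) :: [] := by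
    simp only [plaq, neg_neg]; rfl
  have e2 : [(true, w₂), (false, b₂), (true, -w₃), (false, -b₃), (false, -b₄), (true, -w₄)] ++ (true, w₁) :: (false, b₁) :: [] =
      [(true, w₂), (false, b₂)] ++ (true, -w₃) :: (false, -b₃) :: [(false, -b₄), (true, -w₄), (true, w₁), (false, b₁)] := rfl
  -- the target, rotated by one bond, with the pair `(B, −b₃), (W, −w₃)` exposed
  have e3 : plaq w₁ w₂ w₃ w₄ b₁ b₂ b₃ b₄ =
      [(true, w₁), (false, b₁)] ++ [(true, w₂), (false, b₂), (false, -b₃), (true, -w₃), (false, -b₄), (true, -w₄)] := rfl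
  have e4 : [(true, w₂), (false, b₂), (false, -b₃), (true, -w₃), (false, -b₄), (true, -w₄)] ++ [(true, w₁), (false, b₁)] =
      [(true, w₂), (false, b₂)] ++ (false, -b₃) :: (true, -w₃) :: [(false, -b₄), (true, -w₄), (true, w₁), (false, b₁)] := rfl
  have hZ : (wpart ([(true, w₂), (false, b₂)] ++ (true, -w₃) :: (false, -b₃) :: [(false, -b₄), (true, -w₄), (true, w₁), (false, b₁)])).sum
      = -(w₃ + w₄ - w₁ - w₂) := by
    simp; abel
  have hZ' : (wpart ([(true, w₂), (false, b₂), (true, -w₃), (false, -b₃), (false, -b₄), (true, -w₄)] ++ (true, w₁) :: (false, b₁) :: [])).sum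
      = -(w₃ + w₄ - w₁ - w₂) := by
    simp; abel
  rw [e1, trace_P21_swap 𝕜 τ hτ, hZ', e2, e3, trace_P21_rotate 𝕜 τ hτ [(true, w₁), (false, b₁)], e4, trace_P21_swap 𝕜 τ hτ, hZ]
  simp only [neg_mul, mul_neg, neg_neg, mul_sub, map_sub, map_neg]
  abel

end Words

/-! ## The lattice: product-chart pull-back under an axis reflection and the jet law -/

section Lattice

open Literature.MathematicalPhysics.QuantumFieldTheory.Balaban1983to89.Beta.PlaquetteVertex

variable (𝕜 : Type*) [RCLike 𝕜] {𝔸 : Type*} [NormedRing 𝔸] [NormedAlgebra 𝕜 𝔸]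
variable {V : Type*} [AddCommGroup V] [Module 𝕜 V]
variable {Λ : Type*} [Fintype Λ] [AddCommGroup Λ] {D : Type*} [Fintype D] [DecidableEq D]

/-- **THE PRODUCT-CHART PULL-BACK OF A BOND FIELD UNDER AN AXIS REFLECTION.**  `σ` is the site map of the reflection, `e` the frame,
`α` the reflected axis: a bond `(x, κ)`, `κ ≠ α`, is carried to the bond `(σ x, κ)` with its orientation, while the `α`-bond at `x`
is carried to the `α`-bond at `σ x − e_α` with its orientation REVERSED — so in the chart `U = e^{W}e^{B}` BOTH letters of a reversed
bond are negated AND their order is exchanged (`(e^{W}e^{B})⁻¹ = e^{−B}e^{−W}`); `pull` records the letters (`−X` on `α`-bonds), the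
order exchange is the source of the contact term (`jet21_pull`). [folklore] -/
def pull {M : Type*} [Neg M] (σ : Λ → Λ) (e : D → Λ) (α : D) (X : Λ → D → M) : Λ → D → M :=
  fun x κ => if κ = α then -X (σ x - e α) α else X (σ x) κ

omit [Fintype Λ] [Fintype D] in
/-- the pull-back on the reflected axis. [folklore] -/
@[simp] theorem pull_self {M : Type*} [Neg M] (σ : Λ → Λ) (e : D → Λ) (α : D) (X : Λ → D → M) (x : Λ) :
    pull σ e α X x α = -X (σ x - e α) α := by
  simp [pull]

omit [Fintype Λ] [Fintype D] in
/-- the pull-back off the reflected axis. [folklore] -/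
theorem pull_of_ne {M : Type*} [Neg M] (σ : Λ → Λ) (e : D → Λ) (α : D) (X : Λ → D → M) (x : Λ) {κ : D} (h : κ ≠ α) :
    pull σ e α X x κ = X (σ x) κ := by
  simp [pull, h]

/-- the `α`-COMMUTATOR LETTER `[B_α(y), W_α(y)]` of a bond — the local density of the contact term. [folklore] -/
def axComm (W B : Λ → D → 𝔸) (α : D) (y : Λ) : 𝔸 := B y α * W y α - W y α * B y α

variable {σ : Λ → Λ} {e : D → Λ} {α : D}

omit [Fintype Λ] [Fintype D] in
/-- plaquettes NOT containing the reflected axis: the pulled-back word is the original word at the image base point. [folklore] -/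
theorem plaqWord_pull_of_ne (h₁ : ∀ x κ, κ ≠ α → σ (x + e κ) = σ x + e κ) (W B : Λ → D → 𝔸) (x : Λ) {μ ν : D}
    (hμ : μ ≠ α) (hν : ν ≠ α) :
    plaqWord e (pull σ e α W) (pull σ e α B) x μ ν = plaqWord e W B (σ x) μ ν := by
  simp only [plaqWord, pull, if_neg hμ, if_neg hν, h₁ _ _ hμ, h₁ _ _ hν]

omit [Fintype Λ] [Fintype D] in
/-- plaquettes `p_{αν}(x)`, `ν ≠ α`: the pulled-back word is the reflected word of the FIRST kind of the plaquette `p_{να}(σx − e_α)`,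
so its `(2,1)`-trace is that plaquette's plus the contact `τ(lcurl W · ([B_α,W_α](y + e_ν) − [B_α,W_α](y)))`. [folklore] -/
theorem trace_P21_plaqWord_pull_fst (τ : 𝔸 →ₗ[𝕜] V) (hτ : ∀ a b : 𝔸, τ (a * b) = τ (b * a))
    (h₁ : ∀ x κ, κ ≠ α → σ (x + e κ) = σ x + e κ) (h₂ : ∀ x, σ (x + e α) = σ x - e α) (W B : Λ → D → 𝔸) (x : Λ)
    {ν : D} (hν : ν ≠ α) :
    τ (P21 𝕜 (plaqWord e (pull σ e α W) (pull σ e α B) x α ν)) =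
      τ (P21 𝕜 (plaqWord e W B (σ x - e α) ν α))
        + τ (lcurl e W (σ x - e α) ν α * (axComm W B α (σ x - e α + e ν) - axComm W B α (σ x - e α))) := by
  have hxν : σ (x + e ν) - e α = σ x - e α + e ν := by rw [h₁ _ _ hν]; abel
  have e1 : plaqWord e (pull σ e α W) (pull σ e α B) x α ν =
      plaq (-W (σ x - e α) α) (W (σ x - e α) ν) (-W (σ x - e α + e ν) α) (W (σ x) ν)
        (-B (σ x - e α) α) (B (σ x - e α) ν) (-B (σ x - e α + e ν) α) (B (σ x) ν) := by
    simp only [plaqWord, pull, if_neg hν, if_true, h₂, hxν]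
  have e2 : plaqWord e W B (σ x - e α) ν α =
      plaq (W (σ x - e α) ν) (W (σ x - e α + e ν) α) (W (σ x) ν) (W (σ x - e α) α)
        (B (σ x - e α) ν) (B (σ x - e α + e ν) α) (B (σ x) ν) (B (σ x - e α) α) := by
    simp only [plaqWord, sub_add_cancel]
  have hZ : lcurl e W (σ x - e α) ν α =
      W (σ x - e α) ν + W (σ x - e α + e ν) α - W (σ x) ν - W (σ x - e α) α := by
    simp only [lcurl, sub_add_cancel]; abel
  rw [e1, e2, trace_P21_plaq_reflect₁ 𝕜 τ hτ, hZ]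
  rfl

omit [Fintype Λ] [Fintype D] in
/-- plaquettes `p_{μα}(x)`, `μ ≠ α`: the pulled-back word is the reflected word of the SECOND kind of the plaquette `p_{αμ}(σx − e_α)`.
[folklore] -/
theorem trace_P21_plaqWord_pull_snd (τ : 𝔸 →ₗ[𝕜] V) (hτ : ∀ a b : 𝔸, τ (a * b) = τ (b * a))
    (h₁ : ∀ x κ, κ ≠ α → σ (x + e κ) = σ x + e κ) (h₂ : ∀ x, σ (x + e α) = σ x - e α) (W B : Λ → D → 𝔸) (x : Λ)
    {μ : D} (hμ : μ ≠ α) :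
    τ (P21 𝕜 (plaqWord e (pull σ e α W) (pull σ e α B) x μ α)) =
      τ (P21 𝕜 (plaqWord e W B (σ x - e α) α μ))
        + τ (lcurl e W (σ x - e α) μ α * (axComm W B α (σ x - e α + e μ) - axComm W B α (σ x - e α))) := by
  have hxμ : σ (x + e μ) - e α = σ x - e α + e μ := by rw [h₁ _ _ hμ]; abel
  have e1 : plaqWord e (pull σ e α W) (pull σ e α B) x μ α =
      plaq (W (σ x) μ) (-W (σ x - e α + e μ) α) (W (σ x - e α) μ) (-W (σ x - e α) α)
        (B (σ x) μ) (-B (σ x - e α + e μ) α) (B (σ x - e α) μ) (-B (σ x - e α) α) := by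
    simp only [plaqWord, pull, if_neg hμ, if_true, h₂, hxμ]
  have e2 : plaqWord e W B (σ x - e α) α μ =
      plaq (W (σ x - e α) α) (W (σ x) μ) (W (σ x - e α + e μ) α) (W (σ x - e α) μ)
        (B (σ x - e α) α) (B (σ x) μ) (B (σ x - e α + e μ) α) (B (σ x - e α) μ) := by
    simp only [plaqWord, sub_add_cancel]
  have hZ : lcurl e W (σ x - e α) μ α =
      W (σ x - e α + e μ) α + W (σ x - e α) μ - W (σ x - e α) α - W (σ x) μ := by
    simp only [lcurl, sub_add_cancel]; abel
  rw [e1, e2, trace_P21_plaq_reflect₂ 𝕜 τ hτ, hZ]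
  rfl

omit [DecidableEq D] in
/-- bookkeeping: a double direction sum split at one axis. [folklore] -/
theorem sum_sum_split [DecidableEq D] (g : D → D → V) (α : D) :
    ∑ μ, ∑ ν, g μ ν = g α α + (∑ ν ∈ Finset.univ.erase α, g α ν) + (∑ μ ∈ Finset.univ.erase α, g μ α)
      + ∑ μ ∈ Finset.univ.erase α, ∑ ν ∈ Finset.univ.erase α, g μ ν := by
  have h : ∀ μ, ∑ ν, g μ ν = g μ α + ∑ ν ∈ Finset.univ.erase α, g μ ν :=
    fun μ => (Finset.add_sum_erase _ _ (Finset.mem_univ α)).symm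
  rw [← Finset.add_sum_erase _ _ (Finset.mem_univ α), h]
  simp only [h, Finset.sum_add_distrib]
  abel

omit [AddCommGroup Λ] [DecidableEq D] in
/-- reindexing a sum along an involution. [folklore] -/
theorem sum_invol {ρ : Λ → Λ} (hρ : Function.Involutive ρ) (F : Λ → V) : ∑ x, F (ρ x) = ∑ x, F x :=
  hρ.bijective.sum_comp F

/-- **THE JET LAW UNDER AN AXIS REFLECTION.**  For a site map `σ` that is an involution and shifts the frame as an axis reflection does
(`σ(x + e_κ) = σx + e_κ` for `κ ≠ α`, `σ(x + e_α) = σx − e_α`), the summed `(2,1)`-jet of the product-chart pull-backs equals the original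
jet PLUS THE CONTACT TERM `2·Σ_y Σ_ν τ(lcurl W (y; ν, α) · ([B_α,W_α](y + e_ν) − [B_α,W_α](y)))` — a discrete `α`-derivative of the
commutator density paired with the `α`-row of the curl.  (The `(2,0)`-jet needs no such law here: it does not see `B`.) [folklore] -/
theorem jet21_pull (τ : 𝔸 →ₗ[𝕜] V) (hτ : ∀ a b : 𝔸, τ (a * b) = τ (b * a)) (hσ : Function.Involutive σ)
    (h₁ : ∀ x κ, κ ≠ α → σ (x + e κ) = σ x + e κ) (h₂ : ∀ x, σ (x + e α) = σ x - e α) (W B : Λ → D → 𝔸) :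
    jet21 𝕜 τ e (pull σ e α W) (pull σ e α B) =
      jet21 𝕜 τ e W B
        + (2 : 𝕜) • ∑ y, ∑ ν, τ (lcurl e W y ν α * (axComm W B α (y + e ν) - axComm W B α y)) := by
  have h₂' : ∀ z, σ (z - e α) = σ z + e α := fun z => by
    have h := h₂ (z - e α)
    rw [sub_add_cancel] at h
    rw [h]; abel
  set b : Λ → Λ := fun x => σ x - e α with hb
  have hbi : Function.Involutive b := fun x => by
    show σ (σ x - e α) - e α = x
    rw [h₂', hσ x]; abel
  -- the three groups of plaquettes at a base point
  set ct : Λ → D → V := fun y ν => τ (lcurl e W y ν α * (axComm W B α (y + e ν) - axComm W B α y)) with hct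
  set A₁ : Λ → V := fun y => ∑ ν ∈ Finset.univ.erase α, τ (P21 𝕜 (plaqWord e W B y α ν)) with hA₁
  set A₂ : Λ → V := fun y => ∑ μ ∈ Finset.univ.erase α, τ (P21 𝕜 (plaqWord e W B y μ α)) with hA₂
  set Ct : Λ → V := fun y => ∑ ν ∈ Finset.univ.erase α, ct y ν with hCt
  set G₁ : Λ → V := fun y => ∑ ν ∈ Finset.univ.erase α, (τ (P21 𝕜 (plaqWord e W B y ν α)) + ct y ν) with hG₁
  set G₂ : Λ → V := fun y => ∑ μ ∈ Finset.univ.erase α, (τ (P21 𝕜 (plaqWord e W B y α μ)) + ct y μ) with hG₂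
  set R : Λ → V := fun y => ∑ μ ∈ Finset.univ.erase α, ∑ ν ∈ Finset.univ.erase α, τ (P21 𝕜 (plaqWord e W B y μ ν))
    with hR
  have key : ∀ x, ∑ μ, ∑ ν, τ (P21 𝕜 (plaqWord e (pull σ e α W) (pull σ e α B) x μ ν)) =
      G₁ (b x) + G₂ (b x) + R (σ x) := by
    intro x
    rw [sum_sum_split _ α, trace_P21_plaqWord_self 𝕜 τ hτ, zero_add]
    have g1 : ∑ ν ∈ Finset.univ.erase α, τ (P21 𝕜 (plaqWord e (pull σ e α W) (pull σ e α B) x α ν)) = G₁ (b x) :=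
      Finset.sum_congr rfl fun ν hν =>
        trace_P21_plaqWord_pull_fst 𝕜 τ hτ h₁ h₂ W B x (Finset.ne_of_mem_erase hν)
    have g2 : ∑ μ ∈ Finset.univ.erase α, τ (P21 𝕜 (plaqWord e (pull σ e α W) (pull σ e α B) x μ α)) = G₂ (b x) :=
      Finset.sum_congr rfl fun μ hμ =>
        trace_P21_plaqWord_pull_snd 𝕜 τ hτ h₁ h₂ W B x (Finset.ne_of_mem_erase hμ)
    have g3 : ∑ μ ∈ Finset.univ.erase α, ∑ ν ∈ Finset.univ.erase α,
        τ (P21 𝕜 (plaqWord e (pull σ e α W) (pull σ e α B) x μ ν)) = R (σ x) :=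
      Finset.sum_congr rfl fun μ hμ => Finset.sum_congr rfl fun ν hν => by
        rw [plaqWord_pull_of_ne h₁ W B x (Finset.ne_of_mem_erase hμ) (Finset.ne_of_mem_erase hν)]
    rw [g1, g2, g3]
  have key0 : ∀ y, ∑ μ, ∑ ν, τ (P21 𝕜 (plaqWord e W B y μ ν)) = A₁ y + A₂ y + R y := by
    intro y
    rw [sum_sum_split _ α, trace_P21_plaqWord_self 𝕜 τ hτ, zero_add]
  have hct0 : ∀ y, ∑ ν, ct y ν = Ct y := by
    intro y
    rw [hCt, ← Finset.add_sum_erase _ _ (Finset.mem_univ α)]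
    simp only [hct, lcurl_self, zero_mul, map_zero, zero_add]
  have hG₁ : ∀ y, G₁ y = A₂ y + Ct y := fun y => Finset.sum_add_distrib
  have hG₂ : ∀ y, G₂ y = A₁ y + Ct y := fun y => Finset.sum_add_distrib
  have L : jet21 𝕜 τ e (pull σ e α W) (pull σ e α B) = ∑ x, (G₁ (b x) + G₂ (b x) + R (σ x)) :=
    Finset.sum_congr rfl fun x _ => key x
  have R0 : jet21 𝕜 τ e W B = ∑ y, (A₁ y + A₂ y + R y) := Finset.sum_congr rfl fun y _ => key0 y
  have C0 : ∑ y, ∑ ν, τ (lcurl e W y ν α * (axComm W B α (y + e ν) - axComm W B α y)) = ∑ y, Ct y :=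
    Finset.sum_congr rfl fun y _ => hct0 y
  rw [L, R0, C0]
  simp only [Finset.sum_add_distrib]
  rw [sum_invol hbi G₁, sum_invol hbi G₂, sum_invol hσ R]
  simp only [hG₁, hG₂, Finset.sum_add_distrib, two_smul]
  abel

end Lattice

end Summit.QuantumFields.BalabanUV.Beta.WilsonJetReflection
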